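import Literature.MathematicalPhysics.QuantumFieldTheory.Balaban1983to89.Node00.TkFullBondTransport

/-!
# DAG node N11 — THE FULL-BOND-SET FACE OF 11a's V-FACTOR UNDER GRAPH-INTEGRABILITY (this seat's g2 face p476267 with the SUP BOUND on the integrand family
# replaced by integrability along the averaging graph) — step one of re-typing the analytic binder `hC`∕`hCB` of the no-expansion 𝐓-step

WHY.  dag-n11-d's no-expansion 𝐓-step theorems (p527502 → p543015 → p543804 → p544575 → p547524 → the door p547792) carry an ANALYTIC binder: a uniform SUP BOUND
`|new integrand| ≤ C` (resp. `|old branch| ≤ C`, `hCB`).  At the objects of record that bound is not available and not expected: the old branch is an iterated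
kernel transport whose kernel carries the marginal density `h = d(Ū_* dU)∕dV′` of the exp-mean-log averaging, for which the tree holds absolute continuity only
(`haarAC_avgFun_expMeanLogSU_SUN`), no `L^∞` bound.  What the a.e. identities actually consume is INTEGRABILITY ALONG THE AVERAGING GRAPH `V′ = Ū` — and that IS
available on the diagonal by mass preservation.  This file re-types the bottom of the chain: g2's full-bond-set face (p476267).

WHAT THIS FILE PROVES (0 `sorry`, 0 `def`; `N`-generic).  ★★ `kernelRTOfRecord_full_ae_eq_transportOfRecord_of_integrable` — for `j < K`, `sV ∕ sV′` containing every
bond, `f V y` jointly measurable with `U ↦ f(Ū, U|sV)` `dU`-integrable: `(V ↦ kernelRTOfRecord … (f V) (V|sV′)) =ᵐ (V ↦ transportOfRecord … (f V ·|sV) V)`.  Same proof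
as p476267 (reindexing equivalences preserve product Haar; both sides integrable — now by `integrable_jointLaw_iff` + `integrable_margDensity_mul`; same integral against
every bounded measurable test function — `integral_graph_eq` twice + two changes of variables; `ae_eq_of_forall_integral_mul_eq`).  `integrable_graph_of_measurable_bounded`
— the bounded case is a case.  Sources: [III] (2.21)–(2.22) p. 258, (3.1) p. 264; [Balaban1985Averaging] (10) p. 19.

HONEST SCOPE.  Helper lane of K1⁷ `stmt-QuantumFields-20542` (dag-n11-d g9); [folklore] measure theory (disintegration along Bałaban's averaging of record, `HaarAC`) over the
tree's OWN kernels and records; nothing of Bałaban's estimates is asserted; no binder of an ACCEPTED theorem is edited (new `_of_integrable` theorems stand beside the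
bounded ones); director-ym №186 (1) respected (no value law for `Zh` at `k ≥ 1` is posited).  N11 is NOT discharged; counts unmoved (typed 28∕28 · discharged 5∕27).  One
finite four-torus programme at fixed `ε = L^{−K}`; NOT ℝ⁴, NOT OS, NOT a mass gap, NOT Clay.
-/

noncomputable section

open MeasureTheory

namespace Summit.QuantumFields.YangMills.Theorems.BalabanUVNodesN11TkFullBondTransportIntegrable

open Literature.MathematicalPhysics.QuantumFieldTheory.Balaban1983to89 T4Continuum T4FiniteEpsInhabited Node00 Node00.Tk
open T4AveragingDisintegration (kernelTransport margDensity condLaw jointLaw measurable_margDensity integrable_margDensity_mul integral_graph_eq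
  integrable_jointLaw_iff ae_eq_of_forall_integral_mul_eq)

variable (F : T4Family) (N : ℕ) [NeZero N]

/-- **THE FULL-BOND-SET FACE OF 11a's V-FACTOR, GRAPH-INTEGRABLE FORM.**  For `j < K`, bond finsets `sV ∕ sV′` containing EVERY bond, and a jointly measurable
integrand family `f V y` that is INTEGRABLE ALONG THE AVERAGING GRAPH (`U ↦ f(Ū, U|sV)` is `dU`-integrable): 11a's restricted kernel transport of record applied to
`f V` and read at `V|sV′` EQUALS def-T's one-step transport of record of the `V`-slice `U ↦ f V (U|sV)` read at `V`, for `dV`-ALMOST EVERY `V` — p476267's face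
with its sup bound `|f| ≤ C` weakened to graph-integrability (the bound entered only through the integrability of the two transports and of the graph integrands).
[cite: Balaban1988Convergent, (2.21)–(2.22) p.258, (3.1) p.264; Balaban1985Averaging, (10) p.19] -/
theorem kernelRTOfRecord_full_ae_eq_transportOfRecord_of_integrable (K j : ℕ) (hj : j < K) {hdec : DecidableEq (PBond (F.P K) j)}
    (sV : Finset (PBond (F.P K) j)) (hV : ∀ b, b ∈ sV) (sV' : Finset (PBond (F.P K) (j + 1))) (hV' : ∀ b, b ∈ sV')
    (f : GaugeField (F.P K) (j + 1) (SU N) → (↥sV → SU N) → ℝ) (hf : Measurable (Function.uncurry f))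
    (hI : Integrable (fun U : GaugeField (F.P K) j (SU N) => f ((avOfRecord F N K j).avg U) (fun b => U b)) (fieldMeasure (F.P K) j (SU N))) :
    (fun V => kernelRTOfRecord F N K j sV sV' (f V) (fun b => V b)) =ᵐ[fieldMeasure (F.P K) (j + 1) (SU N)]
      fun V => transportOfRecord F N K j (fun U => f V (fun b => U b)) V := by
  -- the reindexing equivalences
  let e : ↥sV ≃ PBond (F.P K) j := Equiv.subtypeUnivEquiv hV
  let e' : ↥sV' ≃ PBond (F.P K) (j + 1) := Equiv.subtypeUnivEquiv hV'
  let E : (↥sV → SU N) ≃ᵐ GaugeField (F.P K) j (SU N) := MeasurableEquiv.piCongrLeft (fun _ : PBond (F.P K) j => SU N) e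
  let E' : (↥sV' → SU N) ≃ᵐ GaugeField (F.P K) (j + 1) (SU N) :=
    MeasurableEquiv.piCongrLeft (fun _ : PBond (F.P K) (j + 1) => SU N) e'
  have hEs : ∀ (U : GaugeField (F.P K) j (SU N)), E.symm U = fun b : ↥sV => U b.1 := fun U => rfl
  have hEs' : ∀ (V : GaugeField (F.P K) (j + 1) (SU N)), E'.symm V = fun b : ↥sV' => V b.1 := fun V => rfl
  have hE : ∀ (y : ↥sV → SU N) (b : PBond (F.P K) j), E y b = y ⟨b, hV b⟩ := fun y b => by
    change E y (e ⟨b, hV b⟩) = y ⟨b, hV b⟩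
    exact MeasurableEquiv.piCongrLeft_apply_apply e (β := fun _ : PBond (F.P K) j => SU N) y ⟨b, hV b⟩
  -- measure preservation
  have mpE : MeasurePreserving E (Measure.pi fun _ : ↥sV => (HaarData.haar : Measure (SU N))) (fieldMeasure (F.P K) j (SU N)) := by
    unfold fieldMeasure
    exact measurePreserving_piCongrLeft (fun _ : PBond (F.P K) j => (HaarData.haar : Measure (SU N))) e
  have mpE' : MeasurePreserving E' (Measure.pi fun _ : ↥sV' => (HaarData.haar : Measure (SU N)))
      (fieldMeasure (F.P K) (j + 1) (SU N)) := by
    unfold fieldMeasure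
    exact measurePreserving_piCongrLeft (fun _ : PBond (F.P K) (j + 1) => (HaarData.haar : Measure (SU N))) e'
  have mpEs : MeasurePreserving E.symm (fieldMeasure (F.P K) j (SU N)) (Measure.pi fun _ : ↥sV => (HaarData.haar : Measure (SU N))) :=
    MeasurePreserving.symm E mpE
  have mpE's : MeasurePreserving E'.symm (fieldMeasure (F.P K) (j + 1) (SU N))
      (Measure.pi fun _ : ↥sV' => (HaarData.haar : Measure (SU N))) :=
    MeasurePreserving.symm E' mpE'
  -- notation
  set μ := fieldMeasure (F.P K) j (SU N) with hμ
  set μ' := fieldMeasure (F.P K) (j + 1) (SU N) with hμ'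
  set ν : Measure (↥sV → SU N) := Measure.pi fun _ : ↥sV => (HaarData.haar : Measure (SU N)) with hν
  set ν' : Measure (↥sV' → SU N) := Measure.pi fun _ : ↥sV' => (HaarData.haar : Measure (SU N)) with hν'
  haveI : IsProbabilityMeasure μ := Missing.isProbabilityMeasure_fieldMeasure (F.P K) j
  haveI : IsProbabilityMeasure μ' := Missing.isProbabilityMeasure_fieldMeasure (F.P K) (j + 1)
  set av := (avOfRecord F N K j).avg with hav
  have hmav : Measurable av := avOfRecord_measurable F N K j
  have hac : μ.map av ≪ μ' := avOfRecord_haarAC F N K j hj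
  -- the restricted averaging on the full bond sets IS `av` read through the equivalences
  set avg' := avgRestrOfRecord F N K j sV sV' with havg'def
  have havg' : avg' = fun y => E'.symm (av (E y)) := by
    funext y b'
    have hupd : Function.updateFinset (fun _ : PBond (F.P K) j => (1 : SU N)) sV y = E y := by
      funext b
      rw [Function.updateFinset_def]
      simp only [dif_pos (hV b), hE]
    show (avOfRecord F N K j).avg (Function.updateFinset (fun _ => 1) sV y) b' = _
    rw [hupd, hEs']
  have hmavg' : Measurable avg' := by
    rw [havg']; exact E'.symm.measurable.comp (hmav.comp E.measurable)
  have hac' : ν.map avg' ≪ ν' := by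
    rw [havg']
    have h1 : ν.map (fun y => E'.symm (av (E y))) = ((ν.map E).map av).map E'.symm := by
      rw [Measure.map_map hmav E.measurable, Measure.map_map E'.symm.measurable (hmav.comp E.measurable)]
      rfl
    rw [h1, mpE.map_eq, ← mpE's.map_eq]
    exact hac.map E'.symm.measurable
  -- measurability of the two slice integrands
  have hmB : Measurable (fun z : GaugeField (F.P K) (j + 1) (SU N) × GaugeField (F.P K) j (SU N) => f z.1 (E.symm z.2)) :=
    hf.comp (measurable_fst.prodMk (E.symm.measurable.comp measurable_snd))
  have hmA : Measurable (fun z : (↥sV' → SU N) × (↥sV → SU N) => f (E' z.1) z.2) :=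
    hf.comp ((E'.measurable.comp measurable_fst).prodMk measurable_snd)
  -- graph-integrability in the two presentations
  have hIB : Integrable (fun U => f (av U) (E.symm U)) μ := hI
  have hIA : Integrable (fun y => f (E' (avg' y)) y) ν := by
    refine (mpEs.integrable_comp_emb E.symm.measurableEmbedding).1 (hIB.congr (ae_of_all _ fun U => ?_))
    have hU : E' (avg' (E.symm U)) = av U := by
      rw [havg']
      simp only [E.apply_symm_apply, E'.apply_symm_apply]
    simp only [Function.comp_def, hU]
  have hgiB : Integrable (fun z : GaugeField (F.P K) (j + 1) (SU N) × GaugeField (F.P K) j (SU N) => f z.1 (E.symm z.2)) (jointLaw μ av) :=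
    (integrable_jointLaw_iff μ hmav hmB.aestronglyMeasurable).2 hIB
  have hgiA : Integrable (fun z : (↥sV' → SU N) × (↥sV → SU N) => f (E' z.1) z.2) (jointLaw ν avg') :=
    (integrable_jointLaw_iff ν hmavg' hmA.aestronglyMeasurable).2 hIA
  -- integrability of the two transports
  have hintB : Integrable (fun V => kernelTransport μ μ' av (fun U => f V (E.symm U)) V) μ' := by
    have hI' := (integrable_margDensity_mul μ μ' hmav hac hgiB).integral_compProd
    refine hI'.congr (ae_of_all _ fun V => ?_)
    simp only [kernelTransport]
    exact integral_const_mul _ _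
  have hintA0 : Integrable (fun y' => kernelTransport ν ν' avg' (f (E' y')) y') ν' := by
    have hI' := (integrable_margDensity_mul ν ν' hmavg' hac' hgiA).integral_compProd
    refine hI'.congr (ae_of_all _ fun y' => ?_)
    simp only [kernelTransport]
    exact integral_const_mul _ _
  have hintA : Integrable (fun V => kernelTransport ν ν' avg' (f V) (E'.symm V)) μ' := by
    have h := (mpE's.integrable_comp_emb E'.symm.measurableEmbedding).2 hintA0
    refine h.congr (ae_of_all _ fun V => ?_)
    simp only [Function.comp_def, E'.apply_symm_apply]
  -- the goal in E-form
  show (fun V => kernelTransport ν ν' avg' (f V) (E'.symm V)) =ᵐ[μ'] fun V => kernelTransport μ μ' av (fun U => f V (E.symm U)) V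
  refine ae_eq_of_forall_integral_mul_eq hintA hintB fun φ hφm ⟨Cφ, hφ⟩ => ?_
  have hφb : ∀ V, ‖φ V‖ ≤ Cφ := fun V => by rw [Real.norm_eq_abs]; exact hφ V
  -- B side: disintegration along `av`
  have hB : ∫ V, kernelTransport μ μ' av (fun U => f V (E.symm U)) V * φ V ∂μ' = ∫ U, f (av U) (E.symm U) * φ (av U) ∂μ := by
    have hgm : AEStronglyMeasurable (fun z : GaugeField (F.P K) (j + 1) (SU N) × GaugeField (F.P K) j (SU N) => f z.1 (E.symm z.2) * φ z.1)
        (jointLaw μ av) := (hmB.mul (hφm.comp measurable_fst)).aestronglyMeasurable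
    have hg : Integrable (fun U => f (av U) (E.symm U) * φ (av U)) μ :=
      hIB.mul_bdd (hφm.comp hmav).aestronglyMeasurable (Filter.Eventually.of_forall fun U => hφb _)
    have key := integral_graph_eq μ μ' hmav hac
      (g := fun z : GaugeField (F.P K) (j + 1) (SU N) × GaugeField (F.P K) j (SU N) => f z.1 (E.symm z.2) * φ z.1) hgm hg
    rw [key]
    refine integral_congr_ae (ae_of_all _ fun V => ?_)
    simp only [kernelTransport]
    rw [integral_mul_const]
    ring
  -- A side: change variables `V = E′ y′`, disintegrate along `avg′`, change variables `y = E⁻¹ U`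
  have hA : ∫ V, kernelTransport ν ν' avg' (f V) (E'.symm V) * φ V ∂μ' = ∫ U, f (av U) (E.symm U) * φ (av U) ∂μ := by
    have h1 : ∫ V, kernelTransport ν ν' avg' (f V) (E'.symm V) * φ V ∂μ' =
        ∫ y', kernelTransport ν ν' avg' (f (E' y')) y' * φ (E' y') ∂ν' := by
      rw [← mpE'.integral_comp E'.measurableEmbedding]
      simp only [E'.symm_apply_apply]
    have hgm' : AEStronglyMeasurable (fun z : (↥sV' → SU N) × (↥sV → SU N) => f (E' z.1) z.2 * φ (E' z.1)) (jointLaw ν avg') :=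
      (hmA.mul (hφm.comp (E'.measurable.comp measurable_fst))).aestronglyMeasurable
    have hg' : Integrable (fun y => f (E' (avg' y)) y * φ (E' (avg' y))) ν :=
      hIA.mul_bdd (hφm.comp (E'.measurable.comp hmavg')).aestronglyMeasurable (Filter.Eventually.of_forall fun y => hφb _)
    have key' := integral_graph_eq ν ν' hmavg' hac'
      (g := fun z : (↥sV' → SU N) × (↥sV → SU N) => f (E' z.1) z.2 * φ (E' z.1)) hgm' hg'
    have h2 : ∫ y', kernelTransport ν ν' avg' (f (E' y')) y' * φ (E' y') ∂ν' = ∫ y, f (E' (avg' y)) y * φ (E' (avg' y)) ∂ν := by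
      rw [key']
      refine integral_congr_ae (ae_of_all _ fun y' => ?_)
      simp only [kernelTransport]
      rw [integral_mul_const]
      ring
    have h3 : ∫ y, f (E' (avg' y)) y * φ (E' (avg' y)) ∂ν = ∫ U, f (av U) (E.symm U) * φ (av U) ∂μ := by
      rw [← mpEs.integral_comp E.symm.measurableEmbedding]
      refine integral_congr_ae (ae_of_all _ fun U => ?_)
      have hU : E' (avg' (E.symm U)) = av U := by
        rw [havg']
        simp only [E.apply_symm_apply, E'.apply_symm_apply]
      simp only [hU]
    rw [h1, h2, h3]
  rw [hA, hB]

/-- **THE SUP-BOUNDED FACE IS A CASE OF THE GRAPH-INTEGRABLE ONE** (a bounded measurable integrand on a probability space is integrable along the graph) — so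
p476267's consumers lose nothing. [cite: Balaban1988Convergent, (2.21)–(2.22) p.258, (3.1) p.264 (bookkeeping)] -/
theorem integrable_graph_of_measurable_bounded (K j : ℕ) (sV : Finset (PBond (F.P K) j))
    (f : GaugeField (F.P K) (j + 1) (SU N) → (↥sV → SU N) → ℝ) (hf : Measurable (Function.uncurry f)) {C : ℝ} (hC : ∀ V y, |f V y| ≤ C) :
    Integrable (fun U : GaugeField (F.P K) j (SU N) => f ((avOfRecord F N K j).avg U) (fun b => U b)) (fieldMeasure (F.P K) j (SU N)) := by
  haveI : IsProbabilityMeasure (fieldMeasure (F.P K) j (SU N)) := Missing.isProbabilityMeasure_fieldMeasure (F.P K) j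
  have hm : Measurable (fun U : GaugeField (F.P K) j (SU N) => f ((avOfRecord F N K j).avg U) (fun b => U b)) :=
    hf.comp ((avOfRecord_measurable F N K j).prodMk (measurable_pi_lambda _ fun b => measurable_pi_apply (b : PBond (F.P K) j)))
  exact (integrable_const C).mono' hm.aestronglyMeasurable (ae_of_all _ fun U => by rw [Real.norm_eq_abs]; exact hC _ _)

end Summit.QuantumFields.YangMills.Theorems.BalabanUVNodesN11TkFullBondTransportIntegrable

end
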